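import Literature.Geometry.Lorentzian.CoordCoercivityCutoff
import Literature.Geometry.Lorentzian.CoordKIDRowsCutoff
import Literature.Geometry.Lorentzian.CoordKIDRowRecovery
import HarnessLib

/-!
# Pointwise bookkeeping for the global weighted Gårding inequality (Chruściel–Delay 2003, §3)

Topic `Literature/Geometry/Lorentzian`, coordinate tensor calculus `MetricCoord`. Everything here is
PROVED; no definition and no statement of `Prop` type is introduced.

In the proof of Prop. 3.3 of Chruściel–Delay (Mém. SMF 94 (2003)) a pair `(N, Y)` supported in
`M = {x > 0}` is split with a collar cut-off `χ` (`CoordCoercivityCutoff.lean`):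
`(N, Y) = (χN, χY) + ((1−χ)N, (1−χ)Y)`. The boundary estimate (3.4) is applied to the first
piece, the interior elliptic estimate to the second, in the exponentially weighted norms
(`ψ = e^{σ/x}`, `φ = x²`, `Φ = diag(x², x⁴)`). This file collects the pointwise inequalities
between the integrands that this requires, at a point `y` of the domain (`0 < x(y) ≤ X`):

* `weighted_kidRowK_cutoff_le`, `IsMetricOn.weighted_kidRowG_cutoff_le` — the weighted rows of the
  boundary piece: `e^{2σ/x}x⁴|R_K(χN,χY)|² ≤ 2e^{2σ/x}x⁴|R_K|² + c|Y|²` and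
  `e^{2σ/x}x⁸|R_G(χN,χY)|² ≤ 2e^{2σ/x}x⁸|R_G|² + c₁N² + c₂|∇N|² + c₃|Y|²` (the commutator lives
  on `{x₀/2 ≤ x}`, where the weights are bounded);
* `kidRowK_interior_cutoff_le`, `IsMetricOn.kidRowG_interior_cutoff_le` — the unweighted rows of
  the interior piece: `|R_K((1−χ)N,(1−χ)Y)|² ≤ 2(2/x₀)⁴ e^{2σ/x}x⁴|R_K|² + c|Y|²`, and the
  `R_G`-analogue (on the support of `1 − χ` the weights are bounded below);
* `weight_interior_le`, `weight_interior_sq_le` — `e^{2σ/x}(1−χ)² q ≤ e^{4σ/x₀} q` and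
  `e^{2σ/x}x^k q₂ ≤ e^{4σ/x₀}X^k q₂` for quantities `q₂` of the interior piece;
* `integral_sqrtDetGram_le_of_pointwise₄` — integrating `f ≤ Σ aᵢgᵢ` against `√det g`.

## References

* P. T. Chruściel, E. Delay, Mém. Soc. Math. Fr. 94 (2003), §3 (proofs of Prop. 3.1, 3.3).
  [ChruscielDelay2003]
-/

noncomputable section

set_option maxSynthPendingDepth 3

open Set Filter Module Function MeasureTheory
open scoped Topology ContDiff

namespace Literature.Geometry.Lorentzian

namespace MetricCoord

variable {E : Type*} [NormedAddCommGroup E] [NormedSpace ℝ E] [FiniteDimensional ℝ E]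
  {G K : E → E →L[ℝ] E →L[ℝ] ℝ} {V : Set E} {y : E} {xf χ N : E → ℝ} {Y : E → E}

/-! ### The boundary piece: weighted commutators -/

/-- **Weighted `K`-row of the boundary piece.** At a point with `0 < x ≤ X`, for a cut-off with
`0 ≤ χ ≤ 1`, `χ = 1` near the points where `x < x₀/2` and `|∇χ|² ≤ B_g`:
`e^{2σ/x}x⁴|R_K(χN, χY)|² ≤ 2 e^{2σ/x}x⁴|R_K(N,Y)|² + 4(1+n)e^{4σ/x₀}X⁴B_g |Y|²`.
[cite: ChruscielDelay2003, §3 (proof of Prop. 3.3)] -/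
theorem IsMetricOn.weighted_kidRowK_cutoff_le (hG : IsMetricOn G V) (hy : y ∈ V)
    (hpos : ∀ v : E, v ≠ 0 → 0 < G y v v) {σ x₀ X Bg : ℝ} (hσ : 0 ≤ σ) (hx₀ : 0 < x₀)
    (hxpos : 0 < xf y) (hxX : xf y ≤ X) (hBg : gradSqAt G χ y ≤ Bg) (hBg0 : 0 ≤ Bg)
    (hχ01 : 0 ≤ χ y ∧ χ y ≤ 1) (hχ1 : xf y < x₀ / 2 → χ =ᶠ[𝓝 y] fun _ ↦ 1)
    (hχ : DifferentiableAt ℝ χ y) (hY : DifferentiableAt ℝ Y y) (N : E → ℝ) :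
    Real.exp (2 * σ / xf y) * xf y ^ 4
        * normSqAt G y (adjHamK G K (fun z ↦ χ z * N z) y + adjMomKS G (fun z ↦ χ z • Y z) y) ≤
      2 * (Real.exp (2 * σ / xf y) * xf y ^ 4 * normSqAt G y (adjHamK G K N y + adjMomKS G Y y))
        + (4 * (1 + (finrank ℝ E : ℝ)) * Real.exp (4 * σ / x₀) * X ^ 4 * Bg) * G y (Y y) (Y y) := by
  have h := hG.normSqAt_kidRowK_cutoff_le hy hpos hχ hY N (K := K)
  set w := Real.exp (2 * σ / xf y) with hw
  have hw0 : 0 ≤ w := Real.exp_nonneg _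
  have hx4 : 0 ≤ xf y ^ 4 := by positivity
  have hR0 : 0 ≤ normSqAt G y (adjHamK G K N y + adjMomKS G Y y) :=
    normSqAt_nonneg_of_pos hG hy hpos _
  have hY0 : 0 ≤ G y (Y y) (Y y) := by
    by_cases hz : Y y = 0
    · simp [hz]
    · exact (hpos _ hz).le
  have hn0 : 0 ≤ (finrank ℝ E : ℝ) := Nat.cast_nonneg _
  have hχsq : χ y ^ 2 ≤ 1 := by nlinarith [hχ01.1, hχ01.2]
  -- the commutator term, weighted
  have hcomm : w * xf y ^ 4 * (4 * (1 + (finrank ℝ E : ℝ)) * gradSqAt G χ y * G y (Y y) (Y y)) ≤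
      (4 * (1 + (finrank ℝ E : ℝ)) * Real.exp (4 * σ / x₀) * X ^ 4 * Bg) * G y (Y y) (Y y) := by
    by_cases hlt : xf y < x₀ / 2
    · rw [gradSqAt_eq_zero_of_eventuallyEq_const (hχ1 hlt)]
      have : 0 ≤ (4 * (1 + (finrank ℝ E : ℝ)) * Real.exp (4 * σ / x₀) * X ^ 4 * Bg)
          * G y (Y y) (Y y) := by positivity
      simpa using this
    · have hge : x₀ / 2 ≤ xf y := not_lt.mp hlt
      have hwle : w ≤ Real.exp (4 * σ / x₀) := exp_weight_le_of_le hσ hx₀ hge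
      have hxle : xf y ^ 4 ≤ X ^ 4 := pow_le_pow_left₀ hxpos.le hxX 4
      have hg0 : 0 ≤ gradSqAt G χ y := hG.gradSqAt_nonneg hy hpos χ
      have h1 : w * xf y ^ 4 ≤ Real.exp (4 * σ / x₀) * X ^ 4 :=
        mul_le_mul hwle hxle hx4 (Real.exp_nonneg _)
      have h2 : gradSqAt G χ y * G y (Y y) (Y y) ≤ Bg * G y (Y y) (Y y) :=
        mul_le_mul_of_nonneg_right hBg hY0
      have h3 : 0 ≤ gradSqAt G χ y * G y (Y y) (Y y) := mul_nonneg hg0 hY0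
      calc w * xf y ^ 4 * (4 * (1 + (finrank ℝ E : ℝ)) * gradSqAt G χ y * G y (Y y) (Y y))
          = (4 * (1 + (finrank ℝ E : ℝ))) * ((w * xf y ^ 4) * (gradSqAt G χ y * G y (Y y) (Y y))) := by
            ring
        _ ≤ (4 * (1 + (finrank ℝ E : ℝ))) * ((Real.exp (4 * σ / x₀) * X ^ 4)
              * (Bg * G y (Y y) (Y y))) := by
            gcongr (4 * (1 + (finrank ℝ E : ℝ))) * ?_
            exact mul_le_mul h1 h2 h3 (by positivity)
        _ = _ := by ring
  have hmain := mul_le_mul_of_nonneg_left h (mul_nonneg hw0 hx4)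
  calc w * xf y ^ 4 * normSqAt G y (adjHamK G K (fun z ↦ χ z * N z) y
        + adjMomKS G (fun z ↦ χ z • Y z) y)
      ≤ w * xf y ^ 4 * (2 * χ y ^ 2 * normSqAt G y (adjHamK G K N y + adjMomKS G Y y)
          + 4 * (1 + (finrank ℝ E : ℝ)) * gradSqAt G χ y * G y (Y y) (Y y)) := hmain
    _ = χ y ^ 2 * (2 * (w * xf y ^ 4 * normSqAt G y (adjHamK G K N y + adjMomKS G Y y)))
          + w * xf y ^ 4 * (4 * (1 + (finrank ℝ E : ℝ)) * gradSqAt G χ y * G y (Y y) (Y y)) := by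
        ring
    _ ≤ 1 * (2 * (w * xf y ^ 4 * normSqAt G y (adjHamK G K N y + adjMomKS G Y y)))
          + (4 * (1 + (finrank ℝ E : ℝ)) * Real.exp (4 * σ / x₀) * X ^ 4 * Bg) * G y (Y y) (Y y) :=
        add_le_add (mul_le_mul_of_nonneg_right hχsq (by positivity)) hcomm
    _ = _ := by ring

/-- **Weighted `G`-row of the boundary piece.** At a point with `0 < x ≤ X`, for a cut-off with
`χ = 1` near the points where `x < x₀/2`, `0 ≤ χ ≤ 1`, `|∇χ|² ≤ B_g`, `|Δχ| ≤ B_l`,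
`|Hess χ|² ≤ B_h`, and `|K|² ≤ k₁`:
`e^{2σ/x}x⁸|R_G(χN, χY)|² ≤ 2 e^{2σ/x}x⁸|R_G(N,Y)|²
   + 8W(2nB_l² + B_h) N² + 8W(8n+4)B_g |∇N|² + 6W(5+n)B_g k₁ |Y|²`, `W = e^{4σ/x₀}X⁸`.
[cite: ChruscielDelay2003, §3 (proof of Prop. 3.3)] -/
theorem IsMetricOn.weighted_kidRowG_cutoff_le (hG : IsMetricOn G V) (hy : y ∈ V)
    (hpos : ∀ v : E, v ≠ 0 → 0 < G y v v) {σ x₀ X Bg Bl Bh k₁ : ℝ} (hσ : 0 ≤ σ) (hx₀ : 0 < x₀)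
    (hxpos : 0 < xf y) (hxX : xf y ≤ X) (hBg : gradSqAt G χ y ≤ Bg) (hBg0 : 0 ≤ Bg)
    (hBl : |lapAt G χ y| ≤ Bl) (hBh : normSqAt G y (hessAt G χ y) ≤ Bh) (hBh0 : 0 ≤ Bh)
    (hk₁ : normSqAt G y (K y) ≤ k₁) (hk₁0 : 0 ≤ k₁)
    (hχ01 : 0 ≤ χ y ∧ χ y ≤ 1) (hχ1 : xf y < x₀ / 2 → χ =ᶠ[𝓝 y] fun _ ↦ 1)
    (hχ : ContDiffAt ℝ 2 χ y) (hN : ContDiffAt ℝ 2 N y) (hY : DifferentiableAt ℝ Y y)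
    (hKY : DifferentiableAt ℝ (fun z ↦ sharpAt G z (K z (Y z))) y) :
    Real.exp (2 * σ / xf y) * xf y ^ 8
        * normSqAt G y (adjHamG G K (fun z ↦ χ z * N z) y + adjMomGS G K (fun z ↦ χ z • Y z) y) ≤
      2 * (Real.exp (2 * σ / xf y) * xf y ^ 8 * normSqAt G y (adjHamG G K N y + adjMomGS G K Y y))
        + (8 * (Real.exp (4 * σ / x₀) * X ^ 8) * (2 * (finrank ℝ E : ℝ) * Bl ^ 2 + Bh)) * N y ^ 2
        + (8 * (Real.exp (4 * σ / x₀) * X ^ 8) * (8 * (finrank ℝ E : ℝ) + 4) * Bg) * gradSqAt G N y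
        + (6 * (Real.exp (4 * σ / x₀) * X ^ 8) * (5 + (finrank ℝ E : ℝ)) * Bg * k₁)
            * G y (Y y) (Y y) := by
  have h := hG.normSqAt_kidRowG_cutoff_le hy hpos hχ hN hY hKY
  set w := Real.exp (2 * σ / xf y) with hw
  set n : ℝ := (finrank ℝ E : ℝ) with hn
  set W := Real.exp (4 * σ / x₀) * X ^ 8 with hW
  have hw0 : 0 ≤ w := Real.exp_nonneg _
  have hx8 : 0 ≤ xf y ^ 8 := by positivity
  have hR0 : 0 ≤ normSqAt G y (adjHamG G K N y + adjMomGS G K Y y) :=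
    normSqAt_nonneg_of_pos hG hy hpos _
  have hY0 : 0 ≤ G y (Y y) (Y y) := by
    by_cases hz : Y y = 0
    · simp [hz]
    · exact (hpos _ hz).le
  have hn0 : 0 ≤ n := Nat.cast_nonneg _
  have hχsq : χ y ^ 2 ≤ 1 := by nlinarith [hχ01.1, hχ01.2]
  have hN2 : 0 ≤ N y ^ 2 := sq_nonneg _
  have hgN : 0 ≤ gradSqAt G N y := hG.gradSqAt_nonneg hy hpos N
  have hgχ : 0 ≤ gradSqAt G χ y := hG.gradSqAt_nonneg hy hpos χ
  have hKn : 0 ≤ normSqAt G y (K y) := normSqAt_nonneg_of_pos hG hy hpos _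
  have hhχ : 0 ≤ normSqAt G y (hessAt G χ y) := normSqAt_nonneg_of_pos hG hy hpos _
  have hX0 : 0 ≤ X := hxpos.le.trans hxX
  have hW0 : 0 ≤ W := by positivity
  -- the commutator, weighted
  set Cm := (2 * n * lapAt G χ y ^ 2 + normSqAt G y (hessAt G χ y)) * N y ^ 2
    + (8 * n + 4) * gradSqAt G χ y * gradSqAt G N y
    + 3 / 4 * (5 + n) * gradSqAt G χ y * normSqAt G y (K y) * G y (Y y) (Y y) with hCm
  have hcomm : w * xf y ^ 8 * (8 * Cm) ≤
      (8 * W * (2 * n * Bl ^ 2 + Bh)) * N y ^ 2 + (8 * W * (8 * n + 4) * Bg) * gradSqAt G N y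
        + (6 * W * (5 + n) * Bg * k₁) * G y (Y y) (Y y) := by
    by_cases hlt : xf y < x₀ / 2
    · have h1 := gradSqAt_eq_zero_of_eventuallyEq_const (G := G) (hχ1 hlt)
      have h2 := lapAt_eq_zero_of_eventuallyEq_const (G := G) (hχ1 hlt)
      have h3 := hessAt_eq_zero_of_eventuallyEq_const (G := G) (hχ1 hlt)
      have h4 : normSqAt G y (0 : E →L[ℝ] E →L[ℝ] ℝ) = 0 := by simp [normSqAt_eq_traceCLM]
      have hCm0 : Cm = 0 := by rw [hCm, h1, h2, h3, h4]; ring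
      rw [hCm0, mul_zero, mul_zero]
      positivity
    · have hge : x₀ / 2 ≤ xf y := not_lt.mp hlt
      have hwle : w ≤ Real.exp (4 * σ / x₀) := exp_weight_le_of_le hσ hx₀ hge
      have hxle : xf y ^ 8 ≤ X ^ 8 := pow_le_pow_left₀ hxpos.le hxX 8
      have h1 : w * xf y ^ 8 ≤ W := mul_le_mul hwle hxle hx8 (Real.exp_nonneg _)
      have hlap : lapAt G χ y ^ 2 ≤ Bl ^ 2 := by
        rw [← sq_abs (lapAt G χ y)]
        exact pow_le_pow_left₀ (abs_nonneg _) hBl 2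
      have hCm0 : 0 ≤ Cm := by positivity
      have t1 : (2 * n * lapAt G χ y ^ 2 + normSqAt G y (hessAt G χ y)) * N y ^ 2 ≤
          (2 * n * Bl ^ 2 + Bh) * N y ^ 2 := by
        gcongr
      have t2 : (8 * n + 4) * gradSqAt G χ y * gradSqAt G N y ≤ (8 * n + 4) * Bg * gradSqAt G N y := by
        gcongr
      have t3 : 3 / 4 * (5 + n) * gradSqAt G χ y * normSqAt G y (K y) * G y (Y y) (Y y) ≤
          3 / 4 * (5 + n) * Bg * k₁ * G y (Y y) (Y y) := by
        gcongr
      have hCmle : Cm ≤ (2 * n * Bl ^ 2 + Bh) * N y ^ 2 + (8 * n + 4) * Bg * gradSqAt G N y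
          + 3 / 4 * (5 + n) * Bg * k₁ * G y (Y y) (Y y) := by
        rw [hCm]; linarith
      have hB0 : 0 ≤ (2 * n * Bl ^ 2 + Bh) * N y ^ 2 + (8 * n + 4) * Bg * gradSqAt G N y
          + 3 / 4 * (5 + n) * Bg * k₁ * G y (Y y) (Y y) := hCm0.trans hCmle
      calc w * xf y ^ 8 * (8 * Cm) = 8 * ((w * xf y ^ 8) * Cm) := by ring
        _ ≤ 8 * (W * ((2 * n * Bl ^ 2 + Bh) * N y ^ 2 + (8 * n + 4) * Bg * gradSqAt G N y
              + 3 / 4 * (5 + n) * Bg * k₁ * G y (Y y) (Y y))) :=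
            mul_le_mul_of_nonneg_left (mul_le_mul h1 hCmle hCm0 hW0) (by norm_num)
        _ = _ := by ring
  have hmain := mul_le_mul_of_nonneg_left h (mul_nonneg hw0 hx8)
  calc w * xf y ^ 8 * normSqAt G y (adjHamG G K (fun z ↦ χ z * N z) y
        + adjMomGS G K (fun z ↦ χ z • Y z) y)
      ≤ w * xf y ^ 8 * (2 * χ y ^ 2 * normSqAt G y (adjHamG G K N y + adjMomGS G K Y y)
          + 8 * Cm) := hmain
    _ = χ y ^ 2 * (2 * (w * xf y ^ 8 * normSqAt G y (adjHamG G K N y + adjMomGS G K Y y)))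
          + w * xf y ^ 8 * (8 * Cm) := by ring
    _ ≤ 1 * (2 * (w * xf y ^ 8 * normSqAt G y (adjHamG G K N y + adjMomGS G K Y y)))
          + ((8 * W * (2 * n * Bl ^ 2 + Bh)) * N y ^ 2 + (8 * W * (8 * n + 4) * Bg) * gradSqAt G N y
            + (6 * W * (5 + n) * Bg * k₁) * G y (Y y) (Y y)) :=
        add_le_add (mul_le_mul_of_nonneg_right hχsq (by positivity)) hcomm
    _ = _ := by ring

/-! ### The interior piece: unweighted commutators against weighted rows -/

/-- **`K`-row of the interior piece.** At a point with `0 < x`, for a cut-off with `χ = 1` where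
`x ≤ x₀/2` and `|∇χ|² ≤ B_g`:
`|R_K((1−χ)N, (1−χ)Y)|² ≤ 2(2/x₀)⁴ e^{2σ/x}x⁴|R_K(N,Y)|² + 4(1+n)B_g|Y|²`
(on `{x₀/2 ≤ x}` one has `(x₀/2)⁴ ≤ e^{2σ/x}x⁴`). [cite: ChruscielDelay2003, §3 (proof of Prop. 3.3)] -/
theorem IsMetricOn.kidRowK_interior_cutoff_le (hG : IsMetricOn G V) (hy : y ∈ V)
    (hpos : ∀ v : E, v ≠ 0 → 0 < G y v v) {σ x₀ Bg : ℝ} (hσ : 0 ≤ σ) (hx₀ : 0 < x₀)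
    (hxpos : 0 < xf y) (hBg : gradSqAt G χ y ≤ Bg)
    (hχ01 : 0 ≤ χ y ∧ χ y ≤ 1) (hχ1 : xf y ≤ x₀ / 2 → χ y = 1)
    (hχ : DifferentiableAt ℝ χ y) (hY : DifferentiableAt ℝ Y y) (N : E → ℝ) :
    normSqAt G y (adjHamK G K (fun z ↦ (1 - χ z) * N z) y
        + adjMomKS G (fun z ↦ (1 - χ z) • Y z) y) ≤
      (2 * (2 / x₀) ^ 4) * (Real.exp (2 * σ / xf y) * xf y ^ 4
          * normSqAt G y (adjHamK G K N y + adjMomKS G Y y))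
        + (4 * (1 + (finrank ℝ E : ℝ)) * Bg) * G y (Y y) (Y y) := by
  have hχ' : DifferentiableAt ℝ (fun z ↦ 1 - χ z) y := (differentiableAt_const _).sub hχ
  have h := hG.normSqAt_kidRowK_cutoff_le hy hpos hχ' hY N (K := K)
  rw [gradSqAt_one_sub] at h
  set w := Real.exp (2 * σ / xf y) with hw
  set R := normSqAt G y (adjHamK G K N y + adjMomKS G Y y) with hR
  have hR0 : 0 ≤ R := normSqAt_nonneg_of_pos hG hy hpos _
  have hY0 : 0 ≤ G y (Y y) (Y y) := by
    by_cases hz : Y y = 0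
    · simp [hz]
    · exact (hpos _ hz).le
  have hn0 : 0 ≤ (finrank ℝ E : ℝ) := Nat.cast_nonneg _
  have hg0 : 0 ≤ gradSqAt G χ y := hG.gradSqAt_nonneg hy hpos χ
  have hfirst : 2 * (1 - χ y) ^ 2 * R ≤ (2 * (2 / x₀) ^ 4) * (w * xf y ^ 4 * R) := by
    by_cases hle : xf y ≤ x₀ / 2
    · rw [hχ1 hle, sub_self]
      have : 0 ≤ (2 * (2 / x₀) ^ 4) * (w * xf y ^ 4 * R) := by positivity
      simpa using this
    · have hge : x₀ / 2 ≤ xf y := (not_le.mp hle).le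
      have hwx : (x₀ / 2) ^ 4 ≤ w * xf y ^ 4 := pow_weight_mul_exp_ge hσ hx₀ hge 4
      have hsq : (1 - χ y) ^ 2 ≤ 1 := by nlinarith [hχ01.1, hχ01.2]
      have hx2 : 0 < (x₀ / 2) ^ 4 := by positivity
      have hone : 1 ≤ (2 / x₀) ^ 4 * (w * xf y ^ 4) := by
        have e : (2 / x₀) ^ 4 * (x₀ / 2) ^ 4 = 1 := by
          rw [← mul_pow]; rw [show 2 / x₀ * (x₀ / 2) = 1 by field_simp]; simp
        calc (1 : ℝ) = (2 / x₀) ^ 4 * (x₀ / 2) ^ 4 := e.symm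
          _ ≤ (2 / x₀) ^ 4 * (w * xf y ^ 4) := by gcongr
      calc 2 * (1 - χ y) ^ 2 * R ≤ 2 * 1 * R := by gcongr
        _ = 1 * (2 * R) := by ring
        _ ≤ ((2 / x₀) ^ 4 * (w * xf y ^ 4)) * (2 * R) :=
            mul_le_mul_of_nonneg_right hone (by positivity)
        _ = _ := by ring
  have hsecond : 4 * (1 + (finrank ℝ E : ℝ)) * gradSqAt G χ y * G y (Y y) (Y y) ≤
      (4 * (1 + (finrank ℝ E : ℝ)) * Bg) * G y (Y y) (Y y) := by
    have : gradSqAt G χ y * G y (Y y) (Y y) ≤ Bg * G y (Y y) (Y y) :=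
      mul_le_mul_of_nonneg_right hBg hY0
    calc 4 * (1 + (finrank ℝ E : ℝ)) * gradSqAt G χ y * G y (Y y) (Y y)
        = 4 * (1 + (finrank ℝ E : ℝ)) * (gradSqAt G χ y * G y (Y y) (Y y)) := by ring
      _ ≤ 4 * (1 + (finrank ℝ E : ℝ)) * (Bg * G y (Y y) (Y y)) := by gcongr
      _ = _ := by ring
  linarith [h, hfirst, hsecond]

/-- **`G`-row of the interior piece.** At a point with `0 < x`, for a cut-off with `χ = 1` where
`x ≤ x₀/2`, `|∇χ|² ≤ B_g`, `|Δ(1−χ)| ≤ B_l`, `|Hess (1−χ)|² ≤ B_h`, `|K|² ≤ k₁`: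
`|R_G((1−χ)N, (1−χ)Y)|² ≤ 2(2/x₀)⁸ e^{2σ/x}x⁸|R_G(N,Y)|²
  + 8(2nB_l² + B_h) N² + 8(8n+4)B_g |∇N|² + 6(5+n)B_g k₁ |Y|²`.
[cite: ChruscielDelay2003, §3 (proof of Prop. 3.3)] -/
theorem IsMetricOn.kidRowG_interior_cutoff_le (hG : IsMetricOn G V) (hy : y ∈ V)
    (hpos : ∀ v : E, v ≠ 0 → 0 < G y v v) {σ x₀ Bg Bl Bh k₁ : ℝ} (hσ : 0 ≤ σ) (hx₀ : 0 < x₀)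
    (hxpos : 0 < xf y) (hBg : gradSqAt G χ y ≤ Bg) (hBg0 : 0 ≤ Bg)
    (hBl : |lapAt G (fun z ↦ 1 - χ z) y| ≤ Bl)
    (hBh : normSqAt G y (hessAt G (fun z ↦ 1 - χ z) y) ≤ Bh)
    (hk₁ : normSqAt G y (K y) ≤ k₁)
    (hχ01 : 0 ≤ χ y ∧ χ y ≤ 1) (hχ1 : xf y ≤ x₀ / 2 → χ y = 1)
    (hχ : ContDiffAt ℝ 2 χ y) (hN : ContDiffAt ℝ 2 N y) (hY : DifferentiableAt ℝ Y y)
    (hKY : DifferentiableAt ℝ (fun z ↦ sharpAt G z (K z (Y z))) y) :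
    normSqAt G y (adjHamG G K (fun z ↦ (1 - χ z) * N z) y
        + adjMomGS G K (fun z ↦ (1 - χ z) • Y z) y) ≤
      (2 * (2 / x₀) ^ 8) * (Real.exp (2 * σ / xf y) * xf y ^ 8
          * normSqAt G y (adjHamG G K N y + adjMomGS G K Y y))
        + (8 * (2 * (finrank ℝ E : ℝ) * Bl ^ 2 + Bh)) * N y ^ 2
        + (8 * (8 * (finrank ℝ E : ℝ) + 4) * Bg) * gradSqAt G N y
        + (6 * (5 + (finrank ℝ E : ℝ)) * Bg * k₁) * G y (Y y) (Y y) := by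
  have hχ' : ContDiffAt ℝ 2 (fun z ↦ 1 - χ z) y := contDiffAt_const.sub hχ
  have h := hG.normSqAt_kidRowG_cutoff_le hy hpos hχ' hN hY hKY
  rw [gradSqAt_one_sub] at h
  set w := Real.exp (2 * σ / xf y) with hw
  set n : ℝ := (finrank ℝ E : ℝ) with hn
  set R := normSqAt G y (adjHamG G K N y + adjMomGS G K Y y) with hR
  have hR0 : 0 ≤ R := normSqAt_nonneg_of_pos hG hy hpos _
  have hY0 : 0 ≤ G y (Y y) (Y y) := by
    by_cases hz : Y y = 0
    · simp [hz]
    · exact (hpos _ hz).le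
  have hn0 : 0 ≤ n := Nat.cast_nonneg _
  have hg0 : 0 ≤ gradSqAt G χ y := hG.gradSqAt_nonneg hy hpos χ
  have hN2 : 0 ≤ N y ^ 2 := sq_nonneg _
  have hgN : 0 ≤ gradSqAt G N y := hG.gradSqAt_nonneg hy hpos N
  have hKn : 0 ≤ normSqAt G y (K y) := normSqAt_nonneg_of_pos hG hy hpos _
  have hhχ : 0 ≤ normSqAt G y (hessAt G (fun z ↦ 1 - χ z) y) := normSqAt_nonneg_of_pos hG hy hpos _
  have hBh0 : 0 ≤ Bh := hhχ.trans hBh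
  have hfirst : 2 * (1 - χ y) ^ 2 * R ≤ (2 * (2 / x₀) ^ 8) * (w * xf y ^ 8 * R) := by
    by_cases hle : xf y ≤ x₀ / 2
    · rw [hχ1 hle, sub_self]
      have : 0 ≤ (2 * (2 / x₀) ^ 8) * (w * xf y ^ 8 * R) := by positivity
      simpa using this
    · have hge : x₀ / 2 ≤ xf y := (not_le.mp hle).le
      have hwx : (x₀ / 2) ^ 8 ≤ w * xf y ^ 8 := pow_weight_mul_exp_ge hσ hx₀ hge 8
      have hsq : (1 - χ y) ^ 2 ≤ 1 := by nlinarith [hχ01.1, hχ01.2]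
      have hone : 1 ≤ (2 / x₀) ^ 8 * (w * xf y ^ 8) := by
        have e : (2 / x₀) ^ 8 * (x₀ / 2) ^ 8 = 1 := by
          rw [← mul_pow]; rw [show 2 / x₀ * (x₀ / 2) = 1 by field_simp]; simp
        calc (1 : ℝ) = (2 / x₀) ^ 8 * (x₀ / 2) ^ 8 := e.symm
          _ ≤ (2 / x₀) ^ 8 * (w * xf y ^ 8) := by gcongr
      calc 2 * (1 - χ y) ^ 2 * R ≤ 2 * 1 * R := by gcongr
        _ = 1 * (2 * R) := by ring
        _ ≤ ((2 / x₀) ^ 8 * (w * xf y ^ 8)) * (2 * R) :=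
            mul_le_mul_of_nonneg_right hone (by positivity)
        _ = _ := by ring
  have hlap : lapAt G (fun z ↦ 1 - χ z) y ^ 2 ≤ Bl ^ 2 := by
    rw [← sq_abs (lapAt G (fun z ↦ 1 - χ z) y)]
    exact pow_le_pow_left₀ (abs_nonneg _) hBl 2
  have t1 : (2 * n * lapAt G (fun z ↦ 1 - χ z) y ^ 2 + normSqAt G y (hessAt G (fun z ↦ 1 - χ z) y))
      * N y ^ 2 ≤ (2 * n * Bl ^ 2 + Bh) * N y ^ 2 := by
    gcongr
  have t2 : (8 * n + 4) * gradSqAt G χ y * gradSqAt G N y ≤ (8 * n + 4) * Bg * gradSqAt G N y := by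
    gcongr
  have t3 : 3 / 4 * (5 + n) * gradSqAt G χ y * normSqAt G y (K y) * G y (Y y) (Y y) ≤
      3 / 4 * (5 + n) * Bg * k₁ * G y (Y y) (Y y) := by
    gcongr
  have hk₁0 : 0 ≤ k₁ := hKn.trans hk₁
  nlinarith [h, hfirst, t1, t2, t3, hY0, hBg0, hk₁0, hn0]

/-! ### Weights on the interior piece -/

omit [NormedAddCommGroup E] [NormedSpace ℝ E] [FiniteDimensional ℝ E] in
/-- On the interior piece the exponential weight is bounded: for `χ = 1` where `x ≤ x₀/2` and a
quantity `q ≥ 0`, `e^{2σ/x}(1−χ)² q ≤ e^{4σ/x₀} q`. [cite: ChruscielDelay2003, §3 (proof of Prop. 3.3)] -/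
theorem weight_interior_sq_le {σ x₀ q : ℝ} (hσ : 0 ≤ σ) (hx₀ : 0 < x₀) (hq : 0 ≤ q)
    (hχ01 : 0 ≤ χ y ∧ χ y ≤ 1) (hχ1 : xf y ≤ x₀ / 2 → χ y = 1) :
    Real.exp (2 * σ / xf y) * ((1 - χ y) ^ 2 * q) ≤ Real.exp (4 * σ / x₀) * q := by
  by_cases hle : xf y ≤ x₀ / 2
  · rw [hχ1 hle, sub_self]
    have : 0 ≤ Real.exp (4 * σ / x₀) * q := by positivity
    simpa using this
  · have hge : x₀ / 2 ≤ xf y := (not_le.mp hle).le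
    have hwle := exp_weight_le_of_le hσ hx₀ hge
    have hsq : (1 - χ y) ^ 2 ≤ 1 := by nlinarith [hχ01.1, hχ01.2]
    calc Real.exp (2 * σ / xf y) * ((1 - χ y) ^ 2 * q)
        ≤ Real.exp (4 * σ / x₀) * (1 * q) := by gcongr
      _ = _ := by rw [one_mul]

omit [NormedAddCommGroup E] [NormedSpace ℝ E] [FiniteDimensional ℝ E] in
/-- On the interior piece the weights `e^{2σ/x}x^k` are bounded: if a quantity `q ≥ 0` vanishes
unless `x₀/2 ≤ x`, and `0 < x ≤ X`, then `e^{2σ/x}x^k q ≤ e^{4σ/x₀}X^k q`.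
[cite: ChruscielDelay2003, §3 (proof of Prop. 3.3)] -/
theorem weight_interior_le {σ x₀ X q : ℝ} (hσ : 0 ≤ σ) (hx₀ : 0 < x₀) (hq : 0 ≤ q)
    (hxpos : 0 < xf y) (hxX : xf y ≤ X) (hq0 : xf y < x₀ / 2 → q = 0) (k : ℕ) :
    Real.exp (2 * σ / xf y) * xf y ^ k * q ≤ Real.exp (4 * σ / x₀) * X ^ k * q := by
  by_cases hlt : xf y < x₀ / 2
  · rw [hq0 hlt, mul_zero, mul_zero]
  · have hge : x₀ / 2 ≤ xf y := not_lt.mp hlt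
    have hwle := exp_weight_le_of_le hσ hx₀ hge
    have hxle : xf y ^ k ≤ X ^ k := pow_le_pow_left₀ hxpos.le hxX k
    have hxk : 0 ≤ xf y ^ k := by positivity
    exact mul_le_mul_of_nonneg_right (mul_le_mul hwle hxle hxk (Real.exp_nonneg _)) hq

/-! ### From pointwise to integral inequalities, four terms -/

section Integral

variable {ι : Type*} [Fintype ι] [DecidableEq ι] (b : Basis ι ℝ E)
  [MeasurableSpace E] (μ : Measure E)

omit [FiniteDimensional ℝ E] in
/-- Integrating a pointwise inequality `f ≤ a₁g₁ + a₂g₂ + a₃g₃ + a₄g₄` valid on a set off which all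
five functions vanish, against the density `√det g ≥ 0`. [folklore] -/
theorem integral_sqrtDetGram_le_of_pointwise₄ {f g₁ g₂ g₃ g₄ : E → ℝ} (S : Set E)
    (a₁ a₂ a₃ a₄ : ℝ)
    (hf : Integrable (fun z ↦ sqrtDetGram G b z * f z) μ)
    (hg₁ : Integrable (fun z ↦ sqrtDetGram G b z * g₁ z) μ)
    (hg₂ : Integrable (fun z ↦ sqrtDetGram G b z * g₂ z) μ)
    (hg₃ : Integrable (fun z ↦ sqrtDetGram G b z * g₃ z) μ)
    (hg₄ : Integrable (fun z ↦ sqrtDetGram G b z * g₄ z) μ)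
    (hpt : ∀ y ∈ S, f y ≤ a₁ * g₁ y + a₂ * g₂ y + a₃ * g₃ y + a₄ * g₄ y)
    (h0 : ∀ y ∉ S, f y = 0 ∧ g₁ y = 0 ∧ g₂ y = 0 ∧ g₃ y = 0 ∧ g₄ y = 0) :
    ∫ y, sqrtDetGram G b y * f y ∂μ ≤
      a₁ * ∫ y, sqrtDetGram G b y * g₁ y ∂μ + a₂ * ∫ y, sqrtDetGram G b y * g₂ y ∂μ
        + a₃ * ∫ y, sqrtDetGram G b y * g₃ y ∂μ + a₄ * ∫ y, sqrtDetGram G b y * g₄ y ∂μ := by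
  have hI : Integrable (fun y ↦ a₁ * (sqrtDetGram G b y * g₁ y) + a₂ * (sqrtDetGram G b y * g₂ y)
      + a₃ * (sqrtDetGram G b y * g₃ y) + a₄ * (sqrtDetGram G b y * g₄ y)) μ :=
    (((hg₁.const_mul a₁).add (hg₂.const_mul a₂)).add (hg₃.const_mul a₃)).add (hg₄.const_mul a₄)
  have hmono : ∫ y, sqrtDetGram G b y * f y ∂μ ≤
      ∫ y, a₁ * (sqrtDetGram G b y * g₁ y) + a₂ * (sqrtDetGram G b y * g₂ y)
        + a₃ * (sqrtDetGram G b y * g₃ y) + a₄ * (sqrtDetGram G b y * g₄ y) ∂μ := by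
    refine integral_mono hf hI fun y ↦ ?_
    show sqrtDetGram G b y * f y ≤ a₁ * (sqrtDetGram G b y * g₁ y) + a₂ * (sqrtDetGram G b y * g₂ y)
      + a₃ * (sqrtDetGram G b y * g₃ y) + a₄ * (sqrtDetGram G b y * g₄ y)
    by_cases hy : y ∈ S
    · have h := mul_le_mul_of_nonneg_left (hpt y hy) (Real.sqrt_nonneg (gramMatrix G b y).det)
      calc sqrtDetGram G b y * f y
          ≤ sqrtDetGram G b y * (a₁ * g₁ y + a₂ * g₂ y + a₃ * g₃ y + a₄ * g₄ y) := h
        _ = _ := by ring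
    · obtain ⟨h1, h2, h3, h4, h5⟩ := h0 y hy
      rw [h1, h2, h3, h4, h5]; simp
  have hI₁₂ : Integrable (fun y ↦ a₁ * (sqrtDetGram G b y * g₁ y) + a₂ * (sqrtDetGram G b y * g₂ y)) μ :=
    (hg₁.const_mul a₁).add (hg₂.const_mul a₂)
  have hI₁₂₃ : Integrable (fun y ↦ a₁ * (sqrtDetGram G b y * g₁ y) + a₂ * (sqrtDetGram G b y * g₂ y)
      + a₃ * (sqrtDetGram G b y * g₃ y)) μ := hI₁₂.add (hg₃.const_mul a₃)
  rw [integral_add hI₁₂₃ (hg₄.const_mul a₄), integral_add hI₁₂ (hg₃.const_mul a₃),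
    integral_add (hg₁.const_mul a₁) (hg₂.const_mul a₂),
    integral_const_mul, integral_const_mul, integral_const_mul, integral_const_mul] at hmono
  exact hmono

end Integral

end MetricCoord

end Literature.Geometry.Lorentzian

end
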